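import Summits.MatrixMultiplication.MatrixMultiplication.Theses.TetrahedronCarving
import Summits.MatrixMultiplication.MatrixMultiplication.Theorems.ConeTensorResidual
import Summits.MatrixMultiplication.MatrixMultiplication.Theorems.ConeTensorApexExponent
import HarnessLib

/-!
# TetrahedronCarvingConeComparison — the two comparison maps of the spoke-weight family as items

(decomp-mm cell, route-writer bookkeeping for the BANKED node `ConeCarving` of lens 6, generation 14.)

The s = 2 member of the spoke-weight family of exact carvings (carrier: the squared-spoke cone
`W_n = T_f(K₄)`, `f = (n²,n²,n²,n,n,n)`, tree `Theorems.ConeTensor.cone` / `omegaCone`) was banked as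
four `aside` items on the route `TetrahedronCarving` (rev 2). Two of them are the comparison maps with
the s = 1 member and are tree theorems already; this file closes them BY NAME:

* `coneNoSavingOfTetraNoSaving_holds : ConeNoSavingOfTetraNoSaving` — item
  `stmt-MatrixMultiplication-34049`: the residual weakens along s, `TetraNoSaving → 3ω ≤ ω(W)`, from
  `2·ω(K₄) ≤ ω + ω(W)` (`Theorems.ConeTensor.coneNoSaving_of_tetraNoSaving`, file
  `ConeTensorResidual.lean`).
* `tetraFlatOfConeFlat_holds : TetraFlatOfConeFlat` — item `stmt-MatrixMultiplication-34050`: the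
  attacked piece strengthens along s, `ω(W) ≤ 6 → TetraFlat`, from the apex symmetrisation
  `ω(K₄) ≤ (2/3)·ω(W)` (Christandl–Vrana–Zuiddam 2019, Prop. 2.1.7 at `G = K₄`;
  `Theorems.ConeTensor.omegaTetra_le_four_of_omegaCone_le_six`, file `ConeTensorApexExponent.lean`).

References: [cite: ChristandlVranaZuiddam2016, Prop. 2.1.7]; arXiv:1609.07476 §2.1.
-/

set_option linter.dupNamespace false -- `MatrixMultiplication.MatrixMultiplication` (summit = problem, D-0017)

noncomputable section

open Summit.MatrixMultiplication.MatrixMultiplication.Theses.TetrahedronCarving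

namespace Summit.MatrixMultiplication.MatrixMultiplication.Theorems.TetrahedronCarvingConeComparison

/-- **Item `stmt-MatrixMultiplication-34049` (`ConeNoSavingOfTetraNoSaving`)**: the s = 1 residual implies
the s = 2 residual, `2ω ≤ ω(K₄) → 3ω ≤ ω(W)`. [cite: ChristandlVranaZuiddam2016, §2.1] -/
theorem coneNoSavingOfTetraNoSaving_holds : ConeNoSavingOfTetraNoSaving := fun h =>
  Summit.MatrixMultiplication.MatrixMultiplication.Theorems.ConeTensor.coneNoSaving_of_tetraNoSaving
    (F := ℂ) h

/-- **Item `stmt-MatrixMultiplication-34050` (`TetraFlatOfConeFlat`)**: the s = 2 attacked piece implies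
the s = 1 attacked piece, `ω(W) ≤ 6 → ω(K₄) ≤ 4`. [cite: ChristandlVranaZuiddam2016, Prop. 2.1.7] -/
theorem tetraFlatOfConeFlat_holds : TetraFlatOfConeFlat := fun h =>
  Summit.MatrixMultiplication.MatrixMultiplication.Theorems.ConeTensor.omegaTetra_le_four_of_omegaCone_le_six
    (F := ℂ) h

end Summit.MatrixMultiplication.MatrixMultiplication.Theorems.TetrahedronCarvingConeComparison

end
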